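import Summits.BirchSwinnertonDyer.BirchSwinnertonDyer.Theorems.SignedLowerHalvesKobayashiMainConjectureSmallImageTeichOrbitMu
import Summits.BirchSwinnertonDyer.Rank1Residual.Supersingular.KobayashiSqueezeReal
import Literature.NumberTheory.EllipticCurves.Kobayashi2003.SignedPAdicLFunctionUniqueProofs
import HarnessLib

/-!
# Route `SignedLowerHalves`, crux 3 `KobayashiLowerHalfLargeImage` (item stmt-BirchSwinnertonDyer-19001):
# the μ-HALF of the line sketch `horocycle_mu_floor` IS ALREADY IN THE TREE —
# `∃ ε, μ(L_p^ε(E)) = 0` at `p = 3` INPUT-FREE for every curve with good reduction and `a₃ = 0`,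
# and at every supersingular `p ≥ 5` from Conjecture B⁰ (`TeichSpanGenAll`) BY NAME
# (cell `bsd-ssimc`, width seat `bsd-line-slh-p1-w6` gen 0; helper file `--supports 19001`; THEOREMS ONLY)

HONEST FRAMING.  The crux (the Eisenstein half of Kobayashi's signed main conjecture on the X7 large-image
class) is OPEN and nothing here proves it; BSD is not proved by any of this.  This file is SUPPORT for the
unregistered line sketch `Cruxes/KobayashiLowerHalfLargeImage/Lines/horocycle_mu_floor.lean` (crux idea
`horocycle-mu-floor`, k2 g16): it shows that the line's μ-half needs NO new mathematics at `p = 3` and is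
Conjecture B⁰ of cell `bsd-f3-mu` at `p ≥ 5`.

## The observation

The line's μ-half is the chain (Conn) `HorocycleGenerationAll` ⟹ `ReductionAtThree` ⟹ `DescentStabilisation`
at `p = 3` («a mod-`3` symbol vanishing on the `3`-power cusps is Eisenstein, so the plus symbol of a curve with
`E[3]` irreducible is non-constant there, so one of Pollack's `L₃^±` has a unit coefficient») and the named
residual `MuFloorResidualGeFive` (the ω⁰-isotypic version `(W⁰)`) at `p ≥ 5`.  Both conclusions are ALREADY
theorems of the tree, by a different road:

* `Rank1Residual.EvenBranch.cycWindingNonConstantAt_of_odd` (`Theorems/PrintX9EvenBranchMuZeroInputFree.lean`):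
  at EVERY odd good prime `p` with `E[p]` irreducible the plus symbol `a ↦ [a/pⁿ]⁺_f` is non-constant
  `p`-adically on the `p`-power cusps — THEOREM B («the `p`-power winding classes span `pr Γ_H(N)`») from
  VASERSTEIN's theorem `G(ℤ[1/p], Nℤ[1/p]) = E(ℤ[1/p], Nℤ[1/p])`, PROVED in the tree
  (`Literature/NumberTheory/Automorphic/CongruenceSubgroupPropertySL2AwayHolds.lean`) — i.e. the conclusion the
  line wants from (Conn), uniformly in the level, with no coset enumeration;
* `SmallImageCycWindingMuThree.exists_sign_hasUnitContent_three_of_isNewformOf` (p643729, seat slh-p3 gen 8):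
  for EVERY `W/ℚ` with good reduction at `3` and `a₃ = 0` and its newform `f`,
  `∃ ε L, IsSignedPAdicLFunction f 3 ε L ∧ HasUnitContent L` — INPUT-FREE;
* `SmallImageTeichOrbitMu.exists_sign_hasUnitContent_of_teichSpanGenAll` (p645198): the same at every good
  `p ≥ 5` with `a_p = 0`, GRANTED Conjecture B⁰ `TeichSpanGenAll` (OPEN; a displayed hypothesis, never asserted).

## Contents (theorems only; no new definition — the line's `MuZero L` is the tree's `HasUnitContent L` verbatim)

* §1 dictionary `hasUnitContent_kobayashiL_of_isSignedPAdicLFunction`: unit content passes from ANY `L` with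
  `IsSignedPAdicLFunction f p ε L` to `kobayashiL ε L⁺ L⁻` of ANY Pollack pair (uniqueness of Pollack's `L_p^ε`,
  `IsSignedPAdicLFunction.unique`); `exists_sign_forall_isPollackPair_hasUnitContent`.
* §2 `exists_sign_forall_isNewformOf` — «sign before newform»: a sign chosen per newform is a sign chosen per
  curve (`IsNewformOf.unique`, the `q`-expansion principle).
* §3 `p = 3`, INPUT-FREE: `exists_sign_hasUnitContent_kobayashiL_three` and the line's `SignedMuFloorW W p` body at
  `p = 3` in its own binder shape (`signedMuFloor_three`) — the line's hypotheses `HorocycleGenerationAll`,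
  `ReductionAtThree`, `DescentStabilisation`, `NewformExists` are NOT NEEDED at `3`.
* §4 `p ≥ 5` from B⁰: `signedMuFloor_of_teichSpanGenAll_of_five_le`; the line's `MuFloorResidualGeFive` body
  VERBATIM from B⁰ (`muFloorResidualGeFive_of_teichSpanGenAll`; its class hypotheses `ClassX7`/`¬CM`/`Surj` idle).
* §5 every odd supersingular pair: `signedMuFloor_of_teichSpanGenAll` (B⁰ used only at `p ≥ 5`) and the line's
  `signedMuFloorW_of_horocycle` conclusion on X7 with its five μ-binders replaced by B⁰ alone
  (`signedMuFloor_X7_of_teichSpanGenAll`).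

CALIBRATION / SUPPORT ONLY (pen rule D34-4 (3)): never an input to a registered stub, a `closes`, or a by-name close
of item 19001 (the line of record is `kurihara_rigidity`; `horocycle_mu_floor` is unregistered, W-79).

References: [Pollack2003] Prop. 6.18, Cor. 5.11; [Kobayashi2003] Thm. 3.2 (p. 7); [PollackWeston2011] Thm. 4.1 (1),
Rem. 4.2; [MazurTateTeitelbaum1986Invent] §I.10 (10.1); [Vaserstein1972SL2] Theorem; [Serre1972] §1.11 Prop. 12;
[Manin1972] Prop. 1.4 (vocabulary of B⁰).
-/

-- D-0017: single-problem summit, the namespace repeats the problem name by design.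
set_option linter.dupNamespace false
set_option autoImplicit false

noncomputable section

open scoped Classical MatrixGroups ModularForm

open CongruenceSubgroup WeierstrassCurve Literature.NumberTheory.EllipticCurves
  Literature.NumberTheory.EllipticCurves.ModularForms
  Literature.NumberTheory.EllipticCurves.Kobayashi2003 Literature.NumberTheory.EllipticCurves.GreenbergVatsal2000
  Literature.NumberTheory.EllipticCurves.Rank1Residual
  Summit.BirchSwinnertonDyer.Rank1Residual.Supersingular

namespace Summit.BirchSwinnertonDyer.BirchSwinnertonDyer.Theorems.LargeImageMuFloor

open Summit.BirchSwinnertonDyer.BirchSwinnertonDyer.Cruxes.AnalyticMuZeroX9.TeichSpan (TeichSpanGenAll)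
open Summit.BirchSwinnertonDyer.BirchSwinnertonDyer.Theorems.SmallImageCycWindingMuThree
  (exists_sign_hasUnitContent_three_of_isNewformOf)
open Summit.BirchSwinnertonDyer.BirchSwinnertonDyer.Theorems.SmallImageTeichOrbitMu
  (exists_sign_hasUnitContent_of_teichSpanGenAll)

/-! ## §1 Dictionary: unit content in Kobayashi's `IsSignedPAdicLFunction` currency ⟹ unit content of `kobayashiL ε`
of every Pollack pair -/

section Dictionary

variable {N : ℕ} {f : CuspForm (Gamma0 N) 2} {p : ℕ} [Fact p.Prime]

/-- **Unit content transfers along uniqueness of Pollack's `L_p^ε`**: if `L⁺, L⁻` is a Pollack pair of `f` at `p`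
and some `L ∈ Λ` satisfying the parity-`ε` Mazur–Tate congruences has a unit coefficient, then so does
`kobayashiL ε L⁺ L⁻` — because the two are EQUAL (`IsSignedPAdicLFunction.unique`: values at the `ζ − 1` of
parity `ε` determine an element of `Λ`).  [cite: Pollack2003, Prop. 6.18] [cite: Kobayashi2003, Thm. 3.2 (p. 7)] -/
theorem hasUnitContent_kobayashiL_of_isSignedPAdicLFunction {Lplus Lminus L : IwasawaAlgebra p}
    (hPP : IsPollackPair f p Lplus Lminus) {ε : ℤˣ} (hL : IsSignedPAdicLFunction f p ε L)
    (hu : HasUnitContent L) : HasUnitContent (kobayashiL ε Lplus Lminus) := by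
  have h : kobayashiL ε Lplus Lminus = L := (hPP.isSignedPAdicLFunction_kobayashiL ε).unique hL
  rw [h]
  exact hu

/-- **One signed certificate ⟹ the sign works for every Pollack pair**: from
`∃ ε L, IsSignedPAdicLFunction f p ε L ∧ HasUnitContent L` (the currency of the slh-p3 μ-riders) to
`∃ ε, ∀ L⁺ L⁻, IsPollackPair f p L⁺ L⁻ → HasUnitContent (kobayashiL ε L⁺ L⁻)` (the currency of
`KobayashiLowerDivisibility` and of the line sketch `horocycle_mu_floor`, whose `MuZero` is `HasUnitContent`
verbatim). [cite: Pollack2003, Prop. 6.18] [cite: Kobayashi2003, Thm. 3.2 (p. 7)] -/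
theorem exists_sign_forall_isPollackPair_hasUnitContent
    (h : ∃ (ε : ℤˣ) (L : IwasawaAlgebra p), IsSignedPAdicLFunction f p ε L ∧ HasUnitContent L) :
    ∃ ε : ℤˣ, ∀ Lplus Lminus : IwasawaAlgebra p, IsPollackPair f p Lplus Lminus →
      HasUnitContent (kobayashiL ε Lplus Lminus) := by
  obtain ⟨ε, L, hL, hu⟩ := h
  exact ⟨ε, fun _ _ hPP ↦ hasUnitContent_kobayashiL_of_isSignedPAdicLFunction hPP hL hu⟩

end Dictionary

/-! ## §2 Sign before newform -/

section SignFirst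

variable {W : WeierstrassCurve ℚ}

/-- **A sign chosen per newform is a sign chosen per curve**: the newform of `W` of level `N_W` is unique
(`IsNewformOf.unique`, the `q`-expansion principle — both have `q`-expansion `∑ aₙ(W) qⁿ`), so from
«for every newform `f` of `W` there is a sign `ε` with `P ε f`» we get ONE sign `ε` with `P ε f` for every newform `f`
(vacuously if `W` has none at that level).  This is the quantifier order of the line's `SignedMuFloorW` and of the
crux's `∃ ε, KobayashiLowerDivisibility W p ε`. [folklore] -/
theorem exists_sign_forall_isNewformOf
    (P : ℤˣ → CuspForm (Gamma0 (W.conductorNorm ℤ)) 2 → Prop)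
    (h : ∀ [NeZero (W.conductorNorm ℤ)] (f : CuspForm (Gamma0 (W.conductorNorm ℤ)) 2),
      IsNewformOf W f → ∃ ε : ℤˣ, P ε f) :
    ∃ ε : ℤˣ, ∀ [NeZero (W.conductorNorm ℤ)] (f : CuspForm (Gamma0 (W.conductorNorm ℤ)) 2),
      IsNewformOf W f → P ε f := by
  by_cases hex : ∃ (_ : NeZero (W.conductorNorm ℤ)) (f : CuspForm (Gamma0 (W.conductorNorm ℤ)) 2),
      IsNewformOf W f
  · obtain ⟨inst, f₀, hf₀⟩ := hex
    obtain ⟨ε, hε⟩ := h f₀ hf₀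
    refine ⟨ε, fun f hf ↦ ?_⟩
    have hff : f = f₀ := hf.unique hf₀
    rw [hff]
    exact hε
  · refine ⟨1, fun f hf ↦ ?_⟩
    exact absurd ⟨‹_›, f, hf⟩ hex

end SignFirst

/-! ## §3 `p = 3`: the μ-floor is INPUT-FREE (the line's (Conn), `ReductionAtThree`, `DescentStabilisation`,
`NewformExists` are not needed at `3`) -/

section Three

variable {W : WeierstrassCurve ℚ} [W.IsElliptic] [W.IsGloballyMinimal]

/-- **`∃ ε, μ(L₃^ε(E)) = 0` for every newform, INPUT-FREE**: for `W/ℚ` globally minimal with good reduction at `3`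
and `a₃ = 0`, and its newform `f` of level `N_W`: some sign `ε` has `HasUnitContent (kobayashiL ε L⁺ L⁻)` for EVERY
Pollack pair `L⁺, L⁻` of `f` at `3`.  (= slh-p3's `exists_sign_hasUnitContent_three_of_isNewformOf` — THEOREM B road on
Vaserstein's theorem, Serre's Prop. 12, Pollack's Prop. 6.18 integrally, all PROVED in the tree — read through §1.)
[cite: PollackWeston2011, Thm. 4.1 (1), Rem. 4.2] [cite: Vaserstein1972SL2, Theorem] [cite: Serre1972, §1.11 Prop. 12] -/
theorem exists_sign_hasUnitContent_kobayashiL_three [NeZero (W.conductorNorm ℤ)]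
    (f : CuspForm (Gamma0 (W.conductorNorm ℤ)) 2) (hf : IsNewformOf W f)
    (hgood : W.HasGoodReductionAtPrime 3) (hap : W.frobeniusTrace 3 = 0) :
    ∃ ε : ℤˣ, ∀ Lplus Lminus : IwasawaAlgebra 3, IsPollackPair f 3 Lplus Lminus →
      HasUnitContent (kobayashiL ε Lplus Lminus) :=
  exists_sign_forall_isPollackPair_hasUnitContent
    (exists_sign_hasUnitContent_three_of_isNewformOf f hf hgood hap)

/-- **The line's `SignedMuFloorW W 3`, INPUT-FREE** (sign before newform): for `W/ℚ` globally minimal with good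
reduction at `3` and `a₃ = 0` there is ONE sign `ε` such that for every newform `f` of `W` (conductor level) and every
Pollack pair `L⁺, L⁻` of `f` at `3`, `kobayashiL ε L⁺ L⁻` has a unit coefficient (`μ = 0`).
[cite: PollackWeston2011, Thm. 4.1 (1), Rem. 4.2] [cite: Vaserstein1972SL2, Theorem] -/
theorem signedMuFloor_three' (hgood : W.HasGoodReductionAtPrime 3) (hap : W.frobeniusTrace 3 = 0) :
    ∃ ε : ℤˣ, ∀ [NeZero (W.conductorNorm ℤ)] (f : CuspForm (Gamma0 (W.conductorNorm ℤ)) 2),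
      IsNewformOf W f → ∀ Lplus Lminus : IwasawaAlgebra 3, IsPollackPair f 3 Lplus Lminus →
        HasUnitContent (kobayashiL ε Lplus Lminus) :=
  exists_sign_forall_isNewformOf
    (fun ε f ↦ ∀ Lplus Lminus : IwasawaAlgebra 3, IsPollackPair f 3 Lplus Lminus →
      HasUnitContent (kobayashiL ε Lplus Lminus))
    (fun f hf ↦ exists_sign_hasUnitContent_kobayashiL_three f hf hgood hap)

/-- **The line's `SignedMuFloorW W p` at `p = 3` in the line's binder shape** (`(p : ℕ) [Fact p.Prime]`, `p = 3 →`;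
only good reduction at `p` and `a_p = 0` are used — on X7 these are `ClassX7.1.1` and the crux's `a_p = 0` hypothesis):
INPUT-FREE.  So in `HorocycleMuFloor.signedMuFloorW_of_horocycle` the hypotheses `hgen : HorocycleGenerationAll`,
`hred : ReductionAtThree`, `hdesc : DescentStabilisation`, `hnew : NewformExists` can be DROPPED: they are used only at
`p = 3`, where the tree already has the conclusion.
[cite: PollackWeston2011, Thm. 4.1 (1), Rem. 4.2] [cite: Vaserstein1972SL2, Theorem] -/
theorem signedMuFloor_three (p : ℕ) [Fact p.Prime] (hp : p = 3)
    (hgood : W.HasGoodReductionAtPrime p) (hap : W.frobeniusTrace p = 0) :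
    ∃ ε : ℤˣ, ∀ [NeZero (W.conductorNorm ℤ)] (f : CuspForm (Gamma0 (W.conductorNorm ℤ)) 2),
      IsNewformOf W f → ∀ Lplus Lminus : IwasawaAlgebra p, IsPollackPair f p Lplus Lminus →
        HasUnitContent (kobayashiL ε Lplus Lminus) := by
  subst hp
  exact signedMuFloor_three' hgood hap

end Three

/-! ## §4 `p ≥ 5`: the μ-floor from Conjecture B⁰ (`TeichSpanGenAll`) BY NAME -/

section FiveLe

variable {W : WeierstrassCurve ℚ} [W.IsElliptic] [W.IsGloballyMinimal] {p : ℕ} [Fact p.Prime]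

/-- **`∃ ε, μ(L_p^ε(E)) = 0` per newform at a supersingular `p ≥ 5` ⟸ B⁰**: GRANTED the tree's Conjecture B⁰
`TeichSpanGenAll` (OPEN; a hypothesis, never asserted), for `W/ℚ` globally minimal with good reduction at `p ≥ 5`,
`a_p = 0`, and its newform `f`: some sign `ε` has `HasUnitContent (kobayashiL ε L⁺ L⁻)` for every Pollack pair.
(= slh-p3's `exists_sign_hasUnitContent_of_teichSpanGenAll` read through §1.)
[cite: MazurTateTeitelbaum1986Invent, §I.10 (10.1)] [cite: PollackWeston2011, Thm. 4.1 (1)] -/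
theorem exists_sign_hasUnitContent_kobayashiL_of_teichSpanGenAll (hB : TeichSpanGenAll)
    [NeZero (W.conductorNorm ℤ)] (f : CuspForm (Gamma0 (W.conductorNorm ℤ)) 2) (hp5 : 5 ≤ p)
    (hf : IsNewformOf W f) (hgood : W.HasGoodReductionAtPrime p) (hap : W.frobeniusTrace p = 0) :
    ∃ ε : ℤˣ, ∀ Lplus Lminus : IwasawaAlgebra p, IsPollackPair f p Lplus Lminus →
      HasUnitContent (kobayashiL ε Lplus Lminus) :=
  exists_sign_forall_isPollackPair_hasUnitContent
    (exists_sign_hasUnitContent_of_teichSpanGenAll f hB hp5 hf hgood hap)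

/-- **The line's `SignedMuFloorW W p` at `p ≥ 5` ⟸ B⁰** (sign before newform; good reduction at `p` and `a_p = 0`
only). [cite: MazurTateTeitelbaum1986Invent, §I.10 (10.1)] [cite: PollackWeston2011, Thm. 4.1 (1)] -/
theorem signedMuFloor_of_teichSpanGenAll_of_five_le (hB : TeichSpanGenAll) (hp5 : 5 ≤ p)
    (hgood : W.HasGoodReductionAtPrime p) (hap : W.frobeniusTrace p = 0) :
    ∃ ε : ℤˣ, ∀ [NeZero (W.conductorNorm ℤ)] (f : CuspForm (Gamma0 (W.conductorNorm ℤ)) 2),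
      IsNewformOf W f → ∀ Lplus Lminus : IwasawaAlgebra p, IsPollackPair f p Lplus Lminus →
        HasUnitContent (kobayashiL ε Lplus Lminus) :=
  exists_sign_forall_isNewformOf
    (fun ε f ↦ ∀ Lplus Lminus : IwasawaAlgebra p, IsPollackPair f p Lplus Lminus →
      HasUnitContent (kobayashiL ε Lplus Lminus))
    (fun f hf ↦ exists_sign_hasUnitContent_kobayashiL_of_teichSpanGenAll hB f hp5 hf hgood hap)

end FiveLe

/-- **The line's `MuFloorResidualGeFive`, VERBATIM (with `MuZero` spelled `HasUnitContent`), from Conjecture B⁰**: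
GRANTED `TeichSpanGenAll`, for `W` in class X7 at `p ≥ 5`, non-CM, `a_p = 0`, `ρ̄_{W,p}` onto: the signed μ-floor
`SignedMuFloorW W p`.  Of the class hypotheses only «good reduction at `p`» (`ClassX7.1.1`) and `a_p = 0` are used —
the named residual of the line is B⁰ BY NAME, the same B⁰ that carries crux 19630's μ-statement and crux 19002's
`stub_muOneSign_ns_ge5` (`SmallImageTeichOrbitMu.muOneSign_ns_ge5_of_teichSpanGenAll`).
[cite: MazurTateTeitelbaum1986Invent, §I.10 (10.1)] [cite: PollackWeston2011, Thm. 4.1 (1)] -/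
theorem muFloorResidualGeFive_of_teichSpanGenAll (hB : TeichSpanGenAll) :
    ∀ (W : WeierstrassCurve ℚ) [W.IsElliptic] [W.IsGloballyMinimal] (p : ℕ) [Fact p.Prime],
      5 ≤ p → ClassX7 W p → ¬ W.HasCM → W.frobeniusTrace p = 0 → Surj W p →
      ∃ ε : ℤˣ, ∀ [NeZero (W.conductorNorm ℤ)] (f : CuspForm (Gamma0 (W.conductorNorm ℤ)) 2),
        IsNewformOf W f → ∀ Lplus Lminus : IwasawaAlgebra p, IsPollackPair f p Lplus Lminus →
          HasUnitContent (kobayashiL ε Lplus Lminus) := by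
  intro W _ _ p _ hp5 hX _ hap _
  exact signedMuFloor_of_teichSpanGenAll_of_five_le hB hp5 hX.1.1 hap

/-! ## §5 Every odd supersingular pair: the μ-floor from B⁰ alone (used only at `p ≥ 5`) -/

section Odd

variable {W : WeierstrassCurve ℚ} [W.IsElliptic] [W.IsGloballyMinimal] {p : ℕ} [Fact p.Prime]

/-- **The signed μ-floor at every odd supersingular pair ⟸ B⁰**: GRANTED `TeichSpanGenAll` (needed only when
`p ≥ 5`; at `p = 3` the conclusion is input-free, §3), for `W/ℚ` globally minimal with good reduction at the odd prime
`p` and `a_p = 0` there is ONE sign `ε` with `μ(kobayashiL ε L⁺ L⁻) = 0` for every newform of `W` and every Pollack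
pair.  No class hypothesis (semistable / X7 / image) is used.
[cite: PollackWeston2011, Thm. 4.1 (1), Rem. 4.2] [cite: Vaserstein1972SL2, Theorem] -/
theorem signedMuFloor_of_teichSpanGenAll (hB : TeichSpanGenAll) (hp2 : p ≠ 2)
    (hgood : W.HasGoodReductionAtPrime p) (hap : W.frobeniusTrace p = 0) :
    ∃ ε : ℤˣ, ∀ [NeZero (W.conductorNorm ℤ)] (f : CuspForm (Gamma0 (W.conductorNorm ℤ)) 2),
      IsNewformOf W f → ∀ Lplus Lminus : IwasawaAlgebra p, IsPollackPair f p Lplus Lminus →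
        HasUnitContent (kobayashiL ε Lplus Lminus) := by
  have hprime : p.Prime := Fact.out
  rcases Nat.lt_or_ge p 5 with hlt | hge
  · -- `p` prime, `p ≠ 2`, `p < 5` ⇒ `p = 3`
    have hp3 : p = 3 := by
      have h2 := hprime.two_le
      interval_cases p
      · exact absurd rfl hp2
      · rfl
      · exact absurd hprime (by decide)
    exact signedMuFloor_three p hp3 hgood hap
  · exact signedMuFloor_of_teichSpanGenAll_of_five_le hB hge hgood hap

end Odd

/-- **The conclusion of the line's `signedMuFloorW_of_horocycle` on X7, with its five μ-binders
(`HorocycleGenerationAll`, `ReductionAtThree`, `DescentStabilisation`, `MuFloorResidualGeFive`, `NewformExists`)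
replaced by Conjecture B⁰ alone** (and `MuZero` spelled `HasUnitContent`): for `W` in class X7 at an odd `p`, non-CM,
`a_p = 0`, `ρ̄_{W,p}` onto — the crux's own binders — the signed μ-floor holds GRANTED `TeichSpanGenAll` (used only at
`p ≥ 5`).  So the horocycle line's OPEN content toward crux 3 is exactly {its external λ-part, B⁰ at `p ≥ 5`}; at the
`p = 3` pairs of X7 (2608 of 4377 in the dossier's window) its μ-half is UNCONDITIONAL.
[cite: PollackWeston2011, Thm. 4.1 (1), Rem. 4.2] [cite: Vaserstein1972SL2, Theorem] -/
theorem signedMuFloor_X7_of_teichSpanGenAll (hB : TeichSpanGenAll) :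
    ∀ (W : WeierstrassCurve ℚ) [W.IsElliptic] [W.IsGloballyMinimal] (p : ℕ) [Fact p.Prime],
      p ≠ 2 → ClassX7 W p → ¬ W.HasCM → W.frobeniusTrace p = 0 → Surj W p →
      ∃ ε : ℤˣ, ∀ [NeZero (W.conductorNorm ℤ)] (f : CuspForm (Gamma0 (W.conductorNorm ℤ)) 2),
        IsNewformOf W f → ∀ Lplus Lminus : IwasawaAlgebra p, IsPollackPair f p Lplus Lminus →
          HasUnitContent (kobayashiL ε Lplus Lminus) := by
  intro W _ _ p _ hp2 hX _ hap _
  exact signedMuFloor_of_teichSpanGenAll hB hp2 hX.1.1 hap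

/-- **The `p = 3` rows of X7 need NOTHING**: for `W` in class X7 at `p = 3` with `a₃ = 0` (non-CM / onto idle) the
signed μ-floor is a theorem of the tree.  [cite: PollackWeston2011, Thm. 4.1 (1), Rem. 4.2] [cite: Vaserstein1972SL2, Theorem] -/
theorem signedMuFloor_X7_three :
    ∀ (W : WeierstrassCurve ℚ) [W.IsElliptic] [W.IsGloballyMinimal] (p : ℕ) [Fact p.Prime],
      p = 3 → ClassX7 W p → ¬ W.HasCM → W.frobeniusTrace p = 0 → Surj W p →
      ∃ ε : ℤˣ, ∀ [NeZero (W.conductorNorm ℤ)] (f : CuspForm (Gamma0 (W.conductorNorm ℤ)) 2),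
        IsNewformOf W f → ∀ Lplus Lminus : IwasawaAlgebra p, IsPollackPair f p Lplus Lminus →
          HasUnitContent (kobayashiL ε Lplus Lminus) := by
  intro W _ _ p _ hp3 hX _ hap _
  exact signedMuFloor_three p hp3 hX.1.1 hap

end Summit.BirchSwinnertonDyer.BirchSwinnertonDyer.Theorems.LargeImageMuFloor

end
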